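import Summits.Ventures.HodgeRepro2.T5HermitianInertiaSpectral
import Summits.Ventures.HodgeRepro2.T5HermitianClassify
import Summits.Ventures.HodgeRepro2.T5GramSignature

/-!
# Real diagonal hermitian matrices over `ℂ`: congruence is the count of positive entries; universality of an
isotropic diagonal hermitian form (cell pub-hodge-repro2, seat p3)

Tier-5 N2 support, rows N2.2.7 / N2.2.9 / N2.8.1 of route/T5-N2-route-3.md; tools for Landherr's theorem in every
rank (files 171–172), Mathlib + this seat's files 111 / 112 / 130 / 158 only:
* `isCongruent_diagonal_sgn`: over `ℂ`, `diag(r) ≅ diag(sgn r)` for real non-zero `r` (the scaling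
  `diag((√|rᵢ|)⁻¹)`, file 158's `inv_sqrt_abs_mul_mul` in every rank);
* **`card_pos_eq_of_isCongruent_diagonal`** — Sylvester's law of inertia for real diagonal matrices, uniqueness:
  congruent `diag(r)`, `diag(r')` have the same number of positive entries (file 111's
  `card_one_eq_of_conjTranspose_mul_eq_diagonal`);
* **`isCongruent_diagonal_of_card_pos_eq`** — and conversely: equal counts give a permutation `σ` of the indices
  with `sgn (r (σ i)) = sgn (r' i)` (`Fintype.equivOfCardEq` on the positive and non-positive fibres, glued by
  `Equiv.sumCompl`), so `diag(sgn r) ≅ diag(sgn r')` by file 130's `isCongruent_submatrix_perm`;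
  `isCongruent_diagonal_iff_card_pos_eq`;
* `exists_pos_of_isCongruent_diagonal` / `exists_neg_of_isCongruent_diagonal`: if `diag(r) ≅ diag(r')` and some
  `r' k` is positive (negative), some `r i` is;
* **`exists_sum_mul_star_eq_of_isotropic`** — the universality of an isotropic non-degenerate diagonal hermitian
  form `∑ aᵢ wᵢ w̄ᵢ` in every rank (O'Meara 42:10's argument, p0105 l. 17, as in file 168's binary case: the
  vector `t z + u`, `u = (a_{i₀} z̄_{i₀})⁻¹ e_{i₀}`, `t = (c − a_{i₀} u u̅)/2`).

No display; no device. §8(d): uses an L-value-free non-vanishing device: NO.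
-/

namespace Summit.Ventures.HodgeRepro2.T5HermitianDiagonalSign

open Matrix Finset
open Summit.Ventures.HodgeRepro2.T5HermitianDetClass Summit.Ventures.HodgeRepro2.T5HermitianInertia
  Summit.Ventures.HodgeRepro2.T5HermitianInertiaSpectral Summit.Ventures.HodgeRepro2.T5HermitianClassify
  Summit.Ventures.HodgeRepro2.T5GramSignature

/-! ## Scaling to the signs, and Sylvester's law for real diagonal matrices -/

section Sign

variable {ι : Type*} [Fintype ι] [DecidableEq ι]

/-- `(√|t|)⁻¹ · t · (√|t|)⁻¹ = sgn t` in `ℂ`, for a non-zero real `t`. -/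
theorem ofReal_inv_sqrt_abs_mul_mul (t : ℝ) (ht : t ≠ 0) :
    ((((Real.sqrt |t|)⁻¹ : ℝ) : ℂ)) * (t : ℂ) * (((Real.sqrt |t|)⁻¹ : ℝ) : ℂ) = sgn t := by
  rw [← Complex.ofReal_mul, ← Complex.ofReal_mul, inv_sqrt_abs_mul_mul t ht]
  unfold sgn
  rcases lt_or_gt_of_ne ht with h | h
  · rw [if_neg (not_lt.mpr h.le), sign_neg h]
    simp
  · rw [if_pos h, sign_pos h]
    simp

/-- **Scaling to the signs:** over `ℂ`, `diag(r) ≅ diag(sgn r)` for a real vector `r` with non-zero entries. -/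
theorem isCongruent_diagonal_sgn {r : ι → ℝ} (hr : ∀ i, r i ≠ 0) :
    IsCongruent (diagonal fun i => (r i : ℂ)) (diagonal fun i => sgn (r i)) := by
  refine ⟨diagonal fun i => (((Real.sqrt |r i|)⁻¹ : ℝ) : ℂ), ?_, ?_⟩
  · rw [det_diagonal, isUnit_iff_ne_zero, Finset.prod_ne_zero_iff]
    intro i _
    exact_mod_cast inv_ne_zero (sqrt_abs_ne_zero _ (hr i))
  · rw [diagonal_conjTranspose, diagonal_mul_diagonal, diagonal_mul_diagonal]
    congr 1
    ext i
    rw [Pi.star_apply, Complex.star_def, Complex.conj_ofReal]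
    exact ofReal_inv_sqrt_abs_mul_mul (r i) (hr i)

/-- **Sylvester's law of inertia for real diagonal matrices (uniqueness):** congruent `diag(r)`, `diag(r')` over
`ℂ` have the same number of positive entries. -/
theorem card_pos_eq_of_isCongruent_diagonal {r r' : ι → ℝ} (hr : ∀ i, r i ≠ 0) (hr' : ∀ i, r' i ≠ 0)
    (h : IsCongruent (diagonal fun i => (r i : ℂ)) (diagonal fun i => (r' i : ℂ))) :
    (univ.filter fun i => 0 < r i).card = (univ.filter fun i => 0 < r' i).card := by
  obtain ⟨P, hP, hPM⟩ := isCongruent_diagonal_sgn hr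
  obtain ⟨Q, hQ, hQM⟩ := h.trans (isCongruent_diagonal_sgn hr')
  have := card_one_eq_of_conjTranspose_mul_eq_diagonal hP hQ (fun i => sgn_mem_pm _) (fun i => sgn_mem_pm _)
    hPM hQM
  simpa only [sgn_eq_one_iff] using this

omit [DecidableEq ι] in
/-- A permutation of the indices matching the signs of two real vectors with the same number of positive
entries: `sgn (r (σ i)) = sgn (r' i)`. -/
theorem exists_perm_sgn_comp_eq {r r' : ι → ℝ} (hr : ∀ i, r i ≠ 0) (hr' : ∀ i, r' i ≠ 0)
    (h : (univ.filter fun i => 0 < r i).card = (univ.filter fun i => 0 < r' i).card) :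
    ∃ σ : Equiv.Perm ι, ∀ i, sgn (r (σ i)) = sgn (r' i) := by
  have hc₁ : Fintype.card {i // 0 < r' i} = Fintype.card {i // 0 < r i} := by
    rw [Fintype.card_subtype, Fintype.card_subtype, h]
  have hc₂ : Fintype.card {i // ¬ 0 < r' i} = Fintype.card {i // ¬ 0 < r i} := by
    rw [Fintype.card_subtype_compl, Fintype.card_subtype_compl, hc₁]
  let e₁ : {i // 0 < r' i} ≃ {i // 0 < r i} := Fintype.equivOfCardEq hc₁
  let e₂ : {i // ¬ 0 < r' i} ≃ {i // ¬ 0 < r i} := Fintype.equivOfCardEq hc₂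
  let σ : Equiv.Perm ι :=
    ((Equiv.sumCompl fun i => 0 < r' i).symm.trans (Equiv.sumCongr e₁ e₂)).trans
      (Equiv.sumCompl fun i => 0 < r i)
  refine ⟨σ, fun i => ?_⟩
  by_cases hi : 0 < r' i
  · have hσ : σ i = (e₁ ⟨i, hi⟩ : ι) := by
      show (Equiv.sumCompl fun i => 0 < r i) (Sum.map e₁ e₂ ((Equiv.sumCompl fun i => 0 < r' i).symm i)) = _
      rw [Equiv.sumCompl_symm_apply_of_pos (p := fun i => 0 < r' i) hi, Sum.map_inl, Equiv.sumCompl_apply_inl]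
    rw [hσ, (sgn_eq_one_iff _).mpr (e₁ ⟨i, hi⟩).2, (sgn_eq_one_iff _).mpr hi]
  · have hσ : σ i = (e₂ ⟨i, hi⟩ : ι) := by
      show (Equiv.sumCompl fun i => 0 < r i) (Sum.map e₁ e₂ ((Equiv.sumCompl fun i => 0 < r' i).symm i)) = _
      rw [Equiv.sumCompl_symm_apply_of_neg (p := fun i => 0 < r' i) hi, Sum.map_inr, Equiv.sumCompl_apply_inr]
    have h1 : r (e₂ ⟨i, hi⟩) < 0 := lt_of_le_of_ne (not_lt.mp (e₂ ⟨i, hi⟩).2) (hr _)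
    have h2 : r' i < 0 := lt_of_le_of_ne (not_lt.mp hi) (hr' i)
    rw [hσ, (sgn_eq_neg_one_iff (hr _)).mpr h1, (sgn_eq_neg_one_iff (hr' i)).mpr h2]

/-- **Sylvester's law for real diagonal matrices (existence of the congruence):** equal numbers of positive entries
give `diag(r) ≅ diag(r')` over `ℂ`. -/
theorem isCongruent_diagonal_of_card_pos_eq {r r' : ι → ℝ} (hr : ∀ i, r i ≠ 0) (hr' : ∀ i, r' i ≠ 0)
    (h : (univ.filter fun i => 0 < r i).card = (univ.filter fun i => 0 < r' i).card) :
    IsCongruent (diagonal fun i => (r i : ℂ)) (diagonal fun i => (r' i : ℂ)) := by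
  obtain ⟨σ, hσ⟩ := exists_perm_sgn_comp_eq hr hr' h
  have h1 : IsCongruent (diagonal fun i => sgn (r i)) (diagonal fun i => sgn (r' i)) := by
    have hfun : ((fun i => sgn (r i)) ∘ ⇑σ) = fun i => sgn (r' i) := funext fun i => hσ i
    have := isCongruent_submatrix_perm (diagonal fun i => sgn (r i)) σ
    rw [submatrix_diagonal_equiv, hfun] at this
    exact this
  exact ((isCongruent_diagonal_sgn hr).trans h1).trans (isCongruent_diagonal_sgn hr').symm

/-- Over `ℂ`, real diagonal matrices with non-zero entries are congruent iff they have the same number of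
positive entries. -/
theorem isCongruent_diagonal_iff_card_pos_eq {r r' : ι → ℝ} (hr : ∀ i, r i ≠ 0) (hr' : ∀ i, r' i ≠ 0) :
    IsCongruent (diagonal fun i => (r i : ℂ)) (diagonal fun i => (r' i : ℂ)) ↔
      (univ.filter fun i => 0 < r i).card = (univ.filter fun i => 0 < r' i).card :=
  ⟨card_pos_eq_of_isCongruent_diagonal hr hr', isCongruent_diagonal_of_card_pos_eq hr hr'⟩

/-- If `diag(r) ≅ diag(r')` and some entry of `r'` is positive, some entry of `r` is. -/
theorem exists_pos_of_isCongruent_diagonal {r r' : ι → ℝ} (hr : ∀ i, r i ≠ 0) (hr' : ∀ i, r' i ≠ 0)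
    (h : IsCongruent (diagonal fun i => (r i : ℂ)) (diagonal fun i => (r' i : ℂ))) {k : ι}
    (hk : 0 < r' k) : ∃ i, 0 < r i := by
  have hcard := card_pos_eq_of_isCongruent_diagonal hr hr' h
  have hpos : 0 < (univ.filter fun i => 0 < r' i).card :=
    Finset.card_pos.mpr ⟨k, Finset.mem_filter.mpr ⟨Finset.mem_univ k, hk⟩⟩
  rw [← hcard] at hpos
  obtain ⟨i, hi⟩ := Finset.card_pos.mp hpos
  exact ⟨i, (Finset.mem_filter.mp hi).2⟩

/-- If `diag(r) ≅ diag(r')` and some entry of `r'` is negative, some entry of `r` is. -/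
theorem exists_neg_of_isCongruent_diagonal {r r' : ι → ℝ} (hr : ∀ i, r i ≠ 0) (hr' : ∀ i, r' i ≠ 0)
    (h : IsCongruent (diagonal fun i => (r i : ℂ)) (diagonal fun i => (r' i : ℂ))) {k : ι}
    (hk : r' k < 0) : ∃ i, r i < 0 := by
  have hneg : IsCongruent (diagonal fun i => ((-r i : ℝ) : ℂ)) (diagonal fun i => ((-r' i : ℝ) : ℂ)) := by
    obtain ⟨P, hP, hPM⟩ := h
    refine ⟨P, hP, ?_⟩
    have : (diagonal fun i => ((-r i : ℝ) : ℂ)) = -(diagonal fun i => (r i : ℂ)) := by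
      rw [diagonal_neg]
      congr 1
      funext i
      exact Complex.ofReal_neg (r i)
    have h' : (diagonal fun i => ((-r' i : ℝ) : ℂ)) = -(diagonal fun i => (r' i : ℂ)) := by
      rw [diagonal_neg]
      congr 1
      funext i
      exact Complex.ofReal_neg (r' i)
    rw [this, h', Matrix.mul_neg, Matrix.neg_mul, hPM]
  obtain ⟨i, hi⟩ := exists_pos_of_isCongruent_diagonal (fun i => neg_ne_zero.mpr (hr i))
    (fun i => neg_ne_zero.mpr (hr' i)) hneg (neg_pos.mpr hk)
  exact ⟨i, neg_pos.mp hi⟩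

end Sign

/-! ## Universality of an isotropic diagonal hermitian form, in every rank -/

section Universal

variable {E : Type*} [Field E] [StarRing E] {ι : Type*} [Fintype ι] [DecidableEq ι]

/-- **An isotropic non-degenerate diagonal hermitian form represents every star-fixed element** (O'Meara 42:10's
argument, in every rank): from `∑ aᵢ zᵢ z̄ᵢ = 0` with `z ≠ 0` and a star-fixed `c`, the vector `t z + u` with
`u = (a_{i₀} z̄_{i₀})⁻¹ e_{i₀}` (`z_{i₀} ≠ 0`) and `t = (c − a_{i₀} u_{i₀} ū_{i₀})/2` has value `c`. -/
theorem exists_sum_mul_star_eq_of_isotropic [NeZero (2 : E)] {a : ι → E} (ha : ∀ i, star (a i) = a i)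
    (ha0 : ∀ i, a i ≠ 0) {z : ι → E} (hz : z ≠ 0) (hiso : ∑ i, a i * (z i * star (z i)) = 0)
    {c : E} (hc : star c = c) : ∃ w : ι → E, ∑ i, a i * (w i * star (w i)) = c := by
  obtain ⟨i₀, hi₀⟩ := Function.ne_iff.mp hz
  have hz₀ : z i₀ ≠ 0 := by simpa using hi₀
  set u₀ : E := (a i₀ * star (z i₀))⁻¹ with hu₀_def
  have hu : a i₀ * star (z i₀) * u₀ = 1 := mul_inv_cancel₀ (mul_ne_zero (ha0 i₀) (star_ne_zero.mpr hz₀))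
  have hu' : a i₀ * z i₀ * star u₀ = 1 := by
    have := congrArg star hu
    rw [star_mul, star_mul, star_star, ha, star_one] at this
    linear_combination this
  set t : E := (c - a i₀ * (u₀ * star u₀)) / 2 with ht_def
  have hst : star t = t := by
    rw [ht_def, star_div₀, star_sub, star_mul, star_mul, star_star, ha, hc, star_ofNat]
    ring
  have h2 : (2 : E) * t = c - a i₀ * (u₀ * star u₀) := by
    rw [ht_def, mul_div_cancel₀ _ (NeZero.ne (2 : E))]
  set u : ι → E := Pi.single i₀ u₀ with hu_def
  refine ⟨fun j => t * z j + u j, ?_⟩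
  have key : ∀ j, a j * ((t * z j + u j) * star (t * z j + u j)) =
      t * t * (a j * (z j * star (z j))) + t * (a j * (z j * star (u j)) + a j * (u j * star (z j))) +
        a j * (u j * star (u j)) := by
    intro j
    rw [star_add, star_mul, hst]
    ring
  simp only [key]
  rw [Finset.sum_add_distrib, Finset.sum_add_distrib, ← Finset.mul_sum, ← Finset.mul_sum, hiso, mul_zero,
    zero_add]
  have hs₁ : ∑ j, (a j * (z j * star (u j)) + a j * (u j * star (z j))) =
      a i₀ * (z i₀ * star u₀) + a i₀ * (u₀ * star (z i₀)) := by
    rw [Finset.sum_eq_single i₀]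
    · simp [u]
    · intro j _ hj
      simp [u, Pi.single_eq_of_ne hj]
    · intro h
      exact absurd (Finset.mem_univ i₀) h
  have hs₂ : ∑ j, a j * (u j * star (u j)) = a i₀ * (u₀ * star u₀) := by
    rw [Finset.sum_eq_single i₀]
    · simp [u]
    · intro j _ hj
      simp [u, Pi.single_eq_of_ne hj]
    · intro h
      exact absurd (Finset.mem_univ i₀) h
  rw [hs₁, hs₂]
  linear_combination t * hu' + t * hu + h2

end Universal

end Summit.Ventures.HodgeRepro2.T5HermitianDiagonalSign
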